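import Summits.QuantumFields.YangMills.Theorems.ContractibleFibreFibreToTorusStubTubeLimitState

/-!
# Translation invariance of charted tilted product states and of their weak limits

Helper file for the strengthened form `tubeLimit_strong` of stub (T) of crux `FibreToTorus`
(stmt-QuantumFields-16244), line `uniqueness`, route `ContractibleFibre`.  Two generic facts:

* `map_configShift_chartState_eq`: a finite-volume state `(Haar^E tilted by act) ∘ (V ↦ V ∘ π)` read on `ℤᵈ`
  through a chart `π` is invariant under the lattice translation `configShift v` as soon as the translation is
  implemented on the finite volume by an injective relabelling `θ` of `E` (`configShift v (V ∘ π) = (V ∘ θ) ∘ π`)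
  that leaves the log-weight invariant (`act (V ∘ θ) = act V`): relabellings preserve product Haar measure.
* `map_eq_of_tendsto_of_map_eq`: a weak limit (on bounded continuous functions) of probability measures each
  invariant under a continuous measurable map `T` is invariant under `T`.

They give the invariance of the free-tube limit states under the two LONG translations `e₀, e₁` (the tube is
periodic in both), as asked by the re-cut `ergodic-selection` (`LongDirectionInvariance`) of the crux.
-/

noncomputable section

open MeasureTheory Filter Topology Finset Function
open Literature.Probability.LatticeModels (Site)
open Literature.MathematicalPhysics.QuantumLattice (LGConfig ZdEdge configShift configShift_apply
  pi_map_comp_injective exists_bound_of_continuous integrable_of_bound)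
open Literature.MathematicalPhysics.QuantumFieldTheory (haarProbability)

namespace Summit.QuantumFields.YangMills.Theorems.FibreToTorus

variable {d : ℕ} {G : Type*} [Group G] [TopologicalSpace G] [IsTopologicalGroup G] [CompactSpace G]
  [MeasurableSpace G] [BorelSpace G]

/-- **Relabelling invariance of charted tilted product states.** Let `E` be a finite volume with chart
`π : ZdEdge d → E`, continuous log-weight `act`, and let the lattice translation by `v` be implemented on `E` by an
injective relabelling `θ` (`configShift v (V ∘ π) = (V ∘ θ) ∘ π`) with `act (V ∘ θ) = act V`.  Then the state
`((Haar^E).tilted act).map (· ∘ π)` on `LGConfig d G` is invariant under `configShift v`. [folklore] -/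
theorem map_configShift_chartState_eq [SecondCountableTopology G] [T2Space G]
    {E : Type*} [Fintype E] [DecidableEq E]
    (π : ZdEdge d → E) {act : (E → G) → ℝ} (hact : Continuous act) {θ : E → E} (hθ : Injective θ)
    (hactθ : ∀ V : E → G, act (V ∘ θ) = act V) (v : Site d)
    (hπ : ∀ V : E → G, configShift v (V ∘ π : LGConfig d G) = ((V ∘ θ) ∘ π : LGConfig d G)) :
    (((Measure.pi fun _ : E => haarProbability G).tilted act).map
        fun V : E → G => (V ∘ π : LGConfig d G)).map (configShift v) =
      ((Measure.pi fun _ : E => haarProbability G).tilted act).map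
        fun V : E → G => (V ∘ π : LGConfig d G) := by
  set ν : Measure (E → G) := Measure.pi fun _ : E => haarProbability G with hν
  have hπm : Measurable fun V : E → G => (V ∘ π : LGConfig d G) := measurable_comp_chart π
  have hθm : Measurable fun V : E → G => (V ∘ θ : E → G) :=
    measurable_pi_lambda _ fun e => measurable_pi_apply (θ e)
  -- the tilted product measure is a probability measure
  haveI : IsProbabilityMeasure ν := by rw [hν]; infer_instance
  obtain ⟨Bd, hBd⟩ := exists_bound_of_continuous (Real.continuous_exp.comp hact)
  haveI hτ : IsProbabilityMeasure (ν.tilted act) := isProbabilityMeasure_tilted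
    (integrable_of_bound (Real.continuous_exp.comp hact).aestronglyMeasurable hBd)
  haveI : IsProbabilityMeasure ((ν.tilted act).map fun V : E → G => (V ∘ π : LGConfig d G)) :=
    Measure.isProbabilityMeasure_map hπm.aemeasurable
  haveI : IsProbabilityMeasure (((ν.tilted act).map fun V : E → G => (V ∘ π : LGConfig d G)).map
      (configShift v)) :=
    Measure.isProbabilityMeasure_map (configShift v).measurable.aemeasurable
  -- relabelling preserves product Haar measure
  have hνθ : ν.map (fun V : E → G => (V ∘ θ : E → G)) = ν := by
    rw [hν]; exact pi_map_comp_injective (haarProbability G) hθ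
  -- integrals against the charted state
  have hint : ∀ F : LGConfig d G → ℝ, Measurable F →
      ∫ U, F U ∂((ν.tilted act).map fun V : E → G => (V ∘ π : LGConfig d G)) =
        (∫ V, F (V ∘ π) * Real.exp (act V) ∂ν) / ∫ V, Real.exp (act V) ∂ν := by
    intro F hF
    rw [integral_map hπm.aemeasurable hF.aestronglyMeasurable, integral_tilted_eq_div]
  refine ext_of_forall_integral_eq_of_IsFiniteMeasure fun f => ?_
  rw [integral_map (configShift v).measurable.aemeasurable f.continuous.aestronglyMeasurable,
    hint (fun U => f (configShift v U)) (f.continuous.measurable.comp (configShift v).measurable),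
    hint (fun U => f U) f.continuous.measurable]
  congr 1
  -- the numerator: translate, relabel, and use the invariance of `act` and of `ν`
  have hGm : AEStronglyMeasurable (fun W : E → G => f (W ∘ π) * Real.exp (act W))
      (ν.map fun V : E → G => (V ∘ θ : E → G)) :=
    ((f.continuous.comp (continuous_comp_chart π)).mul
      (Real.continuous_exp.comp hact)).aestronglyMeasurable
  calc ∫ V, f (configShift v (V ∘ π : LGConfig d G)) * Real.exp (act V) ∂ν
      = ∫ V, (fun W : E → G => f (W ∘ π) * Real.exp (act W)) (V ∘ θ) ∂ν := by
        refine integral_congr_ae (ae_of_all _ fun V => ?_)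
        simp only [hπ V, hactθ V]
    _ = ∫ W, f (W ∘ π) * Real.exp (act W) ∂(ν.map fun V : E → G => (V ∘ θ : E → G)) :=
        (integral_map hθm.aemeasurable hGm).symm
    _ = ∫ V, f (V ∘ π) * Real.exp (act V) ∂ν := by rw [hνθ]

omit [Group G] [IsTopologicalGroup G] in
/-- **Weak limits of invariant probability measures are invariant.** If probability measures `P k` on
`LGConfig d G` are each invariant under the measurable continuous map `T`, and `∫ F dP_k → ∫ F dμ` for every
bounded continuous `F`, then the probability measure `μ` is invariant under `T` (test `μ.map T` and `μ` against
bounded continuous functions; `F ∘ T` is again bounded continuous). [folklore] -/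
theorem map_eq_of_tendsto_of_map_eq [SecondCountableTopology G] [T2Space G]
    (P : ℕ → Measure (LGConfig d G)) [∀ k, IsProbabilityMeasure (P k)]
    (μ : Measure (LGConfig d G)) [IsProbabilityMeasure μ]
    {T : LGConfig d G → LGConfig d G} (hTc : Continuous T) (hTm : Measurable T)
    (hP : ∀ k, (P k).map T = P k)
    (hlim : ∀ F : LGConfig d G → ℝ, Continuous F → (∃ C, ∀ U, |F U| ≤ C) →
      Tendsto (fun k => ∫ U, F U ∂P k) atTop (𝓝 (∫ U, F U ∂μ))) :
    μ.map T = μ := by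
  haveI : IsProbabilityMeasure (μ.map T) := Measure.isProbabilityMeasure_map hTm.aemeasurable
  refine ext_of_forall_integral_eq_of_IsFiniteMeasure fun f => ?_
  obtain ⟨C, hC⟩ : ∃ C, ∀ U, |f U| ≤ C := ⟨‖f‖, fun U => by
    rw [← Real.norm_eq_abs]; exact f.norm_coe_le_norm U⟩
  have h1 := hlim (fun U => f (T U)) (f.continuous.comp hTc) ⟨C, fun U => hC _⟩
  have h2 := hlim f f.continuous ⟨C, hC⟩
  have heq : (fun k => ∫ U, f (T U) ∂P k) = fun k => ∫ U, f U ∂P k := by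
    funext k
    rw [← integral_map hTm.aemeasurable f.continuous.aestronglyMeasurable, hP k]
  rw [heq] at h1
  rw [integral_map hTm.aemeasurable f.continuous.aestronglyMeasurable]
  exact tendsto_nhds_unique h1 h2

/-- **Registered form (sub-goal `tubeLimit_invariantLimit`)** of `map_eq_of_tendsto_of_map_eq`: closed
statement. [folklore] -/
theorem tubeLimit_invariantLimit : ∀ (d : ℕ) (G : Type) [TopologicalSpace G] [CompactSpace G] [MeasurableSpace G] [BorelSpace G] [SecondCountableTopology G] [T2Space G] (P : ℕ → MeasureTheory.Measure (LGConfig d G)), (∀ k, MeasureTheory.IsProbabilityMeasure (P k)) → ∀ (μ : MeasureTheory.Measure (LGConfig d G)), MeasureTheory.IsProbabilityMeasure μ → ∀ (T : LGConfig d G → LGConfig d G), Continuous T → Measurable T → (∀ k, (P k).map T = P k) → (∀ F : LGConfig d G → ℝ, Continuous F → (∃ C : ℝ, ∀ U, |F U| ≤ C) → Filter.Tendsto (fun k => ∫ U, F U ∂P k) Filter.atTop (nhds (∫ U, F U ∂μ))) → μ.map T = μ :=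
  fun d _ _ _ _ _ _ _ P _ μ _ _ hTc hTm hP hlim =>
    map_eq_of_tendsto_of_map_eq (d := d) P μ hTc hTm hP hlim

end Summit.QuantumFields.YangMills.Theorems.FibreToTorus

end
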